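import Summits.ResolutionOfSingularities.ResolutionOfSingularities.Theorems.HilbertSamuelEliminationSigmaMaxModificationsCorridor3TameWildDefs
import Summits.ResolutionOfSingularities.ResolutionOfSingularities.Theorems.HilbertSamuelEliminationSigmaMaxModificationsStubCentreSeqPackage
import Mathlib.AlgebraicGeometry.Morphisms.Proper
import HarnessLib

/-!
# Route `HilbertSamuelElimination`, crux `SigmaMaxModificationsCorridor3`
# (stmt-ResolutionOfSingularities-19249; child of `SigmaMaxModifications` stmt-…-18506),
# line `tame_wild` v3 — TRANSITIVITY of `ν`-modifications

[OURS · L1 W4.2] Bookkeeping for the CONFINED form of the line (skeleton v3, lead's H4F decision):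
an `H^N`-monotone `ν`-admissible modification `σ : Y' → Y` (all clauses of `NuMod` except the kill
clause — CJS Def. 6.14 in modification form, Rem. 6.24) followed by a `ν`-modification of `Y'` is a
`ν`-modification of `Y`, provided `ν` is MAXIMAL in `Σ_Y(N)`. The one non-formal point: by
monotonicity and maximality the new stratum `Y'(ν)` lies over the old one, `Y'(ν) ⊆ σ⁻¹(Y(ν))`, so
opens off `Y(ν)` pull back to opens off `Y'(ν)`; and a maximal value either dies or stays maximal.
Stated def-free (the clauses as hypotheses) and for a blow-up sequence `s : CentreSeq Y` with centres
over `Y(ν)` (the shape delivered by the confinement stub `stub_confine3`, via the landed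
`stub_centreSeq_package`, p146611). NOT a statement of any manuscript; idea-2's sketch lemmas
`nuMod_of_nuAdm_of_nuMod` / `not_mem_or_maximal_of_nuAdm` (card `separate-then-cp`) are these.

## Sources

* V. Cossart, U. Jannsen, S. Saito, LNM 2270 (2020), Def. 2.28, Def. 2.35, Def. 6.14, Rem. 6.24.
  [CossartJannsenSaito2020]
* The Stacks Project, Tag 02OS (a blow-up is an isomorphism off its centre). [StacksProject]
-/

set_option linter.dupNamespace false -- mandated namespace of this single-conjunct summit

noncomputable section

open CategoryTheory AlgebraicGeometry TopologicalSpace Topology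
open Literature.AlgebraicGeometry.Resolution Literature.RingTheory.HilbertSamuel
open Summit.ResolutionOfSingularities.ResolutionOfSingularities.Theorems.SigmaMaxModifications.Sketch

namespace Summit.ResolutionOfSingularities.ResolutionOfSingularities.Theorems.SigmaMaxModificationsCorridor3.TameWild

/-! ## Maximal values along an `H`-monotone morphism -/

/-- **A maximal value dies or stays maximal along an `H^N`-monotone morphism.** If
`H^N_{Y'}(y') ≤ H^N_Y(σ y')` for all `y'` and `ν ∈ Σ_Y(N)^max`, then either `ν ∉ Σ_{Y'}(N)` or
`ν ∈ Σ_{Y'}(N)^max`: a value `μ ≥ ν` of `Y'` is dominated by a value of `Y`, which maximality pins to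
`ν`. [cite: CossartJannsenSaito2020, Def. 2.35, Rem. 6.24] -/
theorem not_mem_hsValues_or_maximal_of_hsFun_le {Y Y' : Scheme.{0}} (N : ℕ) (ν : ℕ → ℕ)
    (σ : Y' ⟶ Y) (hmono : ∀ y' : Y', Scheme.hsFun Y' N y' ≤ Scheme.hsFun Y N (σ.base y'))
    (hmax : Maximal (· ∈ Scheme.hsValues Y N) ν) :
    ν ∉ Scheme.hsValues Y' N ∨ Maximal (· ∈ Scheme.hsValues Y' N) ν := by
  by_cases hν : ν ∈ Scheme.hsValues Y' N
  · refine Or.inr ⟨hν, ?_⟩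
    rintro μ ⟨y', rfl⟩ hle
    have h1 : Scheme.hsFun Y' N y' ≤ Scheme.hsFun Y N (σ.base y') := hmono y'
    have h2 : Scheme.hsFun Y N (σ.base y') ≤ ν := hmax.2 ⟨σ.base y', rfl⟩ (hle.trans h1)
    exact h1.trans h2
  · exact Or.inl hν

/-- **The new stratum lies over the old one.** Along an `H^N`-monotone `σ : Y' → Y` with `ν`
maximal in `Σ_Y(N)`, a point of `Y'(ν)` maps into `Y(ν)`; equivalently the preimage of a subset of
`Y ∖ Y(ν)` misses `Y'(ν)`. [cite: CossartJannsenSaito2020, Def. 2.28, Rem. 6.24] -/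
theorem preimage_subset_compl_hsStratum_of_hsFun_le {Y Y' : Scheme.{0}} (N : ℕ) (ν : ℕ → ℕ)
    (σ : Y' ⟶ Y) (hmono : ∀ y' : Y', Scheme.hsFun Y' N y' ≤ Scheme.hsFun Y N (σ.base y'))
    (hmax : Maximal (· ∈ Scheme.hsValues Y N) ν) {U : Set Y}
    (hU : U ⊆ (Scheme.hsStratum Y N ν)ᶜ) :
    (fun y' => σ.base y') ⁻¹' U ⊆ (Scheme.hsStratum Y' N ν)ᶜ := by
  intro y' hy' hy'ν
  rw [Set.mem_preimage] at hy'
  rw [Scheme.mem_hsStratum_iff] at hy'ν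
  apply hU hy'
  rw [Scheme.mem_hsStratum_iff]
  have h1 : ν ≤ Scheme.hsFun Y N (σ.base y') := hy'ν ▸ hmono y'
  exact le_antisymm (hmax.2 ⟨σ.base y', rfl⟩ h1) h1

/-! ## Transitivity -/

/-- **TRANSITIVITY of `ν`-modifications (def-free form of idea-2's `nuMod_of_nuAdm_of_nuMod`).**
Let `σ : Y' → Y` be proper, `Y'` reduced of dimension `≤ d` and `≤ N`, an isomorphism over every
open inside `Y ∖ Y(ν)`, pulling dense such opens back to dense opens, with `H^N` non-increasing, and
let `ν` be maximal in `Σ_Y(N)`. Then a `ν`-modification of `Y'` composes with `σ` to a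
`ν`-modification of `Y`: properness, monotonicity and density compose; over an open `U ⊆ Y ∖ Y(ν)`
the composite restricts to `(τ ∣ σ⁻¹U) ≫ (σ ∣ U)`, both isomorphisms since `σ⁻¹U ⊆ Y' ∖ Y'(ν)`
(`preimage_subset_compl_hsStratum_of_hsFun_le`). [cite: CossartJannsenSaito2020, Def. 6.14, Rem. 6.24] -/
theorem nuMod_of_nuMod_of_hsFun_le {Y Y' : Scheme.{0}} (N d : ℕ) (ν : ℕ → ℕ) (σ : Y' ⟶ Y)
    (hσ : IsProper σ)
    (hiso : ∀ U : Y.Opens, (U : Set Y) ⊆ (Scheme.hsStratum Y N ν)ᶜ → IsIso (σ ∣_ U))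
    (hdense : ∀ U : Y.Opens, Dense (U : Set Y) → (U : Set Y) ⊆ (Scheme.hsStratum Y N ν)ᶜ →
      Dense ((σ ⁻¹ᵁ U : Y'.Opens) : Set Y'))
    (hmono : ∀ y' : Y', Scheme.hsFun Y' N y' ≤ Scheme.hsFun Y N (σ.base y'))
    (hmax : Maximal (· ∈ Scheme.hsValues Y N) ν) (h : NuMod Y' N d ν) : NuMod Y N d ν := by
  obtain ⟨Y'', τ, hτ, hred, hd, hN, hiso', hdense', hmono', hkill⟩ := h
  haveI := hσ
  haveI := hτ
  have hpre : ∀ U : Y.Opens, (U : Set Y) ⊆ (Scheme.hsStratum Y N ν)ᶜ →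
      ((σ ⁻¹ᵁ U : Y'.Opens) : Set Y') ⊆ (Scheme.hsStratum Y' N ν)ᶜ := fun U hU =>
    preimage_subset_compl_hsStratum_of_hsFun_le N ν σ hmono hmax hU
  refine ⟨Y'', τ ≫ σ, inferInstance, hred, hd, hN, fun U hU => ?_, fun U hUd hU => ?_,
    fun y'' => ?_, hkill⟩
  · -- isomorphism over `U ⊆ Y ∖ Y(ν)`
    have h1 : IsIso (σ ∣_ U) := hiso U hU
    have h2 : IsIso (τ ∣_ σ ⁻¹ᵁ U) := hiso' (σ ⁻¹ᵁ U) (hpre U hU)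
    rw [morphismRestrict_comp]
    exact @IsIso.comp_isIso _ _ _ _ _ _ _ h2 h1
  · -- dense opens pull back to dense opens
    exact hdense' (σ ⁻¹ᵁ U) (hdense U hUd hU) (hpre U hU)
  · -- `H^N` non-increasing
    calc Scheme.hsFun Y'' N y'' ≤ Scheme.hsFun Y' N (τ.base y'') := hmono' y''
      _ ≤ Scheme.hsFun Y N (σ.base (τ.base y'')) := hmono (τ.base y'')
      _ = Scheme.hsFun Y N ((τ ≫ σ).base y'') := by rw [Scheme.Hom.comp_apply]

/-- **TRANSITIVITY along a blow-up sequence with centres over the stratum** (the shape delivered by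
the confinement stub of line `tame_wild` v3). For `Y` reduced, locally Noetherian, `dim Y ≤ d`,
`ν` maximal in `Σ_Y(N)`, and `s : CentreSeq Y` with centres over `Y(ν)` along which
`H^N` does not increase: a `ν`-modification of `s.top` composes with `s.comp` to a `ν`-modification of
`Y` (landed `stub_centreSeq_package`: `s.comp` is proper, `s.top` reduced of dimension `≤ d`, an
isomorphism over the opens inside `Y ∖ Y(ν)` with dense preimages — a blow-up is an isomorphism off
its centre). [cite: CossartJannsenSaito2020, Def. 6.14, Rem. 6.24] [cite: StacksProject, Tag 02OS] -/
theorem nuMod_of_centreSeq_of_nuMod {Y : Scheme.{0}} [IsLocallyNoetherian Y] [IsReduced Y]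
    (N d : ℕ) (hdimd : topologicalKrullDim Y ≤ (d : WithBot ℕ∞)) (ν : ℕ → ℕ)
    (hmax : Maximal (· ∈ Scheme.hsValues Y N) ν) (s : CentreSeq Y)
    (hover : s.CentresOver (Scheme.hsStratum Y N ν))
    (hmono : ∀ x' : s.top, Scheme.hsFun s.top N x' ≤ Scheme.hsFun Y N (s.comp.base x'))
    (h : NuMod s.top N d ν) : NuMod Y N d ν := by
  obtain ⟨hprop, -, -, hiso, hdense⟩ :=
    stub_centreSeq_package Y d hdimd (Scheme.hsStratum Y N ν) s hover
  exact nuMod_of_nuMod_of_hsFun_le N d ν s.comp hprop hiso hdense hmono hmax h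

end Summit.ResolutionOfSingularities.ResolutionOfSingularities.Theorems.SigmaMaxModificationsCorridor3.TameWild

end
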